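import Summits.HubbardSuperconductivity.HubbardSuperconductivity.Theorems.BirComplexStableXY.Negative.WitnessTable
import Literature.Probability.LatticeModels.BesselIDebyeAsymptotics
import HarnessLib

/-!
# Crux `BirComplexStableXYR` (stmt-HubbardSuperconductivity-14845): the real Hessian of an admissible
# window action at the constants dominates `c₀ ×` the complete-window Dirichlet form

Support file (prover seat 0, route BalabanIR) for the restated engine
`…Theses.BalabanIR.BirComplexStableXYR`, first half of the "convexity radius" lemma of idea card
`Cruxes/BirComplexStableXYR/Ideas/log-concave-core-bounded-phase.md` (also the coercivity of the REAL
reference Gaussian of card `real-covariance-multiscale-port`).  For a finite Fourier table `c` on the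
window `W_r` (vocabulary `Table`, `genF`, `normA` of `Theorems.BirComplexStableXY.Negative.WitnessTable`)
satisfying the crux hypotheses (N) `Σ c_n = 0` and (C) `c₀ ΣΣ(1 - cos(φ_w - φ_w')) ≤ Re F(φ)`, the
second derivative of `F(φ) = Σ_n c_n e^{i n·φ}` along any ray through the constants,
`H_c(0)v = -Σ_n c_n (n·v)²`, satisfies

  `c₀ Σ_w Σ_w' (v_w - v_w')² ≤ Re H_c(0)v`                     (`cvxr_re_hess_origin_ge`).

Proof: `g(t) := Re F(tv) - c₀ΣΣ(1 - cos(t(v_w - v_w'))) ≥ 0` by (C) and `Σ_n Re c_n = 0` by (N); the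
EVEN part `g(t) + g(-t) = -2Σ_n Re c_n (1 - cos(t n·v)) - 2c₀ΣΣ(1 - cos(t(v_w - v_w')))` (the odd
`sin` terms cancel, so no first-order condition is needed) is bounded above through the global Taylor
gap `0 ≤ x²/2 - (1 - cos x) ≤ x⁴/24` (`cvxr_taylorGap_mem`, from the tree's
`cos_le_one_sub_sq_half_add_fourth`) by `-S t² + Q t⁴/12` with `S = c₀ΣΣ(v_w - v_w')² + Σ Re c_n (n·v)²`, `Q ≥ 0`;
`0 ≤ -S t² + Q t⁴/12` for all small `t` forces `S ≤ 0`.  Everything is finite-sum bookkeeping over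
`c.support`.  The Lipschitz estimate in `φ` and the packaged `K`-independent radius are in
`…BirComplexStableXYRConvexityRadius`. [folklore]
-/

noncomputable section

namespace Summit.HubbardSuperconductivity.HubbardSuperconductivity.Theorems

open scoped BigOperators
open Summit.HubbardSuperconductivity.BirComplexStableXYNegative
open Literature.Probability.LatticeModels (cos_le_one_sub_sq_half_add_fourth)

section HessianOrigin

variable {r : ℕ}

/-- `0 ≤ x²/2 - (1 - cos x) ≤ x⁴/24`. [folklore] -/
theorem cvxr_taylorGap_mem (x : ℝ) :
    0 ≤ x ^ 2 / 2 - (1 - Real.cos x) ∧ x ^ 2 / 2 - (1 - Real.cos x) ≤ x ^ 4 / 24 := by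
  constructor
  · have := Real.one_sub_sq_div_two_le_cos (x := x)
    linarith
  · have := cos_le_one_sub_sq_half_add_fourth x
    linarith

/-- `Re (a e^{ix}) = Re a cos x - Im a sin x`. [folklore] -/
theorem cvxr_re_mul_cexp (a : ℂ) (x : ℝ) :
    (a * Complex.exp (Complex.I * (x : ℂ))).re = a.re * Real.cos x - a.im * Real.sin x := by
  rw [Complex.mul_re, Complex.exp_re, Complex.exp_im]
  simp

/-- `Im (a e^{ix}) = Re a sin x + Im a cos x`. [folklore] -/
theorem cvxr_im_mul_cexp (a : ℂ) (x : ℝ) :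
    (a * Complex.exp (Complex.I * (x : ℂ))).im = a.re * Real.sin x + a.im * Real.cos x := by
  rw [Complex.mul_im, Complex.exp_re, Complex.exp_im]
  simp

/-- The frequency pairing is linear in the field: `n·(tv) = t (n·v)`. [folklore] -/
theorem cvxr_frq_smul (n : Freq r) (t : ℝ) (v : W r → ℝ) :
    (∑ w, (n w : ℝ) * (t * v w)) = t * ∑ w, (n w : ℝ) * v w := by
  rw [Finset.mul_sum]
  exact Finset.sum_congr rfl fun w _ => by ring

/-- `n·(φ + ψ) = n·φ + n·ψ`. [folklore] -/
theorem cvxr_frq_add (n : Freq r) (φ ψ : W r → ℝ) :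
    (∑ w, (n w : ℝ) * (φ w + ψ w)) = (∑ w, (n w : ℝ) * φ w) + ∑ w, (n w : ℝ) * ψ w := by
  rw [← Finset.sum_add_distrib]
  exact Finset.sum_congr rfl fun w _ => by ring

/-- `Re F` along the ray `t ↦ t v` through the origin:
`Re F(tv) = Σ_n (Re c_n cos(t n·v) - Im c_n sin(t n·v))`. [folklore] -/
theorem cvxr_re_genF_ray (c : Table r) (v : W r → ℝ) (t : ℝ) :
    (genF c (fun w => t * v w)).re =
      ∑ n ∈ c.support, ((c n).re * Real.cos (t * ∑ w, (n w : ℝ) * v w) -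
        (c n).im * Real.sin (t * ∑ w, (n w : ℝ) * v w)) := by
  unfold genF Finsupp.sum
  rw [Complex.re_sum]
  refine Finset.sum_congr rfl fun n _ => ?_
  show (c n * Complex.exp (Complex.I * ((∑ w, (n w : ℝ) * (t * v w) : ℝ) : ℂ))).re = _
  rw [cvxr_frq_smul, cvxr_re_mul_cexp]

/-- (N) in real form: `Σ_n Re c_n = 0`. [folklore] -/
theorem cvxr_sum_re_eq_zero {c : Table r} (hN : c.sum (fun _ a => a) = 0) :
    ∑ n ∈ c.support, (c n).re = 0 := by
  have h := congrArg Complex.re hN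
  unfold Finsupp.sum at h
  rwa [Complex.re_sum, Complex.zero_re] at h

/-- **Second-order condition at the constants.** For a table satisfying (N) `Σ c_n = 0` and the
coercivity (C) `c₀ ΣΣ (1 - cos(φ_w - φ_w')) ≤ Re F(φ)`, the real Hessian of `F` at the origin dominates
`c₀` times the complete-window Dirichlet form:
`c₀ Σ_w Σ_w' (v_w - v_w')² ≤ Re(-Σ_n c_n (n·v)²)` for every direction `v`.
(The even part `g(t) + g(-t)` of `g(t) = Re F(tv) - c₀ΣΣ(1 - cos(t(v_w - v_w'))) ≥ 0`, `g(0) = 0`,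
is `≤ -S t²/2 + Q t⁴/24`-controlled by `0 ≤ x²/2 - (1 - cos x) ≤ x⁴/24`, forcing `S ≤ 0`.) [folklore] -/
theorem cvxr_re_hess_origin_ge (c : Table r) {c₀ : ℝ} (hc₀ : 0 < c₀)
    (hN : c.sum (fun _ a => a) = 0)
    (hC : ∀ φ : W r → ℝ, c₀ * ∑ w, ∑ w', (1 - Real.cos (φ w - φ w')) ≤ (genF c φ).re) (v : W r → ℝ) :
    c₀ * ∑ w, ∑ w', (v w - v w') ^ 2 ≤
      (-c.sum (fun n a => a * (((∑ w, (n w : ℝ) * v w) ^ 2 : ℝ) : ℂ))).re := by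
  classical
  -- notation
  set s := c.support with hs
  set A : Freq r → ℝ := fun n => ∑ w, (n w : ℝ) * v w with hA
  -- the right-hand side in real form
  have hR : (-c.sum (fun n a => a * (((∑ w, (n w : ℝ) * v w) ^ 2 : ℝ) : ℂ))).re =
      -∑ n ∈ s, (c n).re * A n ^ 2 := by
    unfold Finsupp.sum
    rw [Complex.neg_re, Complex.re_sum]
    congr 1
    refine Finset.sum_congr rfl fun n _ => ?_
    rw [Complex.mul_re, Complex.ofReal_re, Complex.ofReal_im, mul_zero, sub_zero]
  rw [hR]
  -- Step 1: the even part of (C) along the ray: for every t,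
  --   c₀ ΣΣ (1 - cos(t b)) + Σ_n Re c_n (1 - cos(t A_n)) ≤ 0.
  have hsumre : ∑ n ∈ s, (c n).re = 0 := cvxr_sum_re_eq_zero hN
  have heven : ∀ t : ℝ, c₀ * ∑ w, ∑ w', (1 - Real.cos (t * (v w - v w'))) +
      ∑ n ∈ s, (c n).re * (1 - Real.cos (t * A n)) ≤ 0 := by
    intro t
    have h1 := hC (fun w => t * v w)
    have h2 := hC (fun w => (-t) * v w)
    rw [cvxr_re_genF_ray] at h1 h2
    have e1 : ∀ w w', (1 - Real.cos (t * v w - t * v w')) = 1 - Real.cos (t * (v w - v w')) := by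
      intro w w'; rw [mul_sub]
    have e2 : ∀ w w', (1 - Real.cos (-t * v w - -t * v w')) = 1 - Real.cos (t * (v w - v w')) := by
      intro w w'
      have : -t * v w - -t * v w' = -(t * (v w - v w')) := by ring
      rw [this, Real.cos_neg]
    simp only [e1] at h1
    simp only [e2] at h2
    have e3 : ∑ n ∈ s, ((c n).re * Real.cos (-t * A n) - (c n).im * Real.sin (-t * A n)) =
        ∑ n ∈ s, ((c n).re * Real.cos (t * A n) + (c n).im * Real.sin (t * A n)) := by
      refine Finset.sum_congr rfl fun n _ => ?_
      rw [neg_mul, Real.cos_neg, Real.sin_neg]; ring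
    rw [e3] at h2
    have hadd : 2 * (c₀ * ∑ w, ∑ w', (1 - Real.cos (t * (v w - v w')))) ≤
        2 * ∑ n ∈ s, (c n).re * Real.cos (t * A n) := by
      have := add_le_add h1 h2
      rw [← Finset.sum_add_distrib] at this
      have e4 : ∑ n ∈ s, ((c n).re * Real.cos (t * A n) - (c n).im * Real.sin (t * A n) +
          ((c n).re * Real.cos (t * A n) + (c n).im * Real.sin (t * A n))) =
          2 * ∑ n ∈ s, (c n).re * Real.cos (t * A n) := by
        rw [Finset.mul_sum]
        exact Finset.sum_congr rfl fun n _ => by ring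
      linarith [this, e4]
    have e5 : ∑ n ∈ s, (c n).re * (1 - Real.cos (t * A n)) =
        ∑ n ∈ s, (c n).re - ∑ n ∈ s, (c n).re * Real.cos (t * A n) := by
      rw [← Finset.sum_sub_distrib]
      exact Finset.sum_congr rfl fun n _ => by ring
    rw [e5, hsumre]
    linarith
  -- Step 2: lower bounds by the quartic Taylor gap.
  set S : ℝ := c₀ * ∑ w, ∑ w', (v w - v w') ^ 2 + ∑ n ∈ s, (c n).re * A n ^ 2 with hS
  set Q : ℝ := c₀ * ∑ w, ∑ w', (v w - v w') ^ 4 + ∑ n ∈ s, |(c n).re| * A n ^ 4 with hQ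
  have hQnn : 0 ≤ Q := by
    have h1 : 0 ≤ ∑ w, ∑ w', (v w - v w') ^ 4 :=
      Finset.sum_nonneg fun w _ => Finset.sum_nonneg fun w' _ => by positivity
    have h2 : 0 ≤ ∑ n ∈ s, |(c n).re| * A n ^ 4 :=
      Finset.sum_nonneg fun n _ => by positivity
    have := mul_nonneg hc₀.le h1
    linarith
  have hineq : ∀ t : ℝ, t ^ 2 / 2 * S ≤ t ^ 4 / 24 * Q := by
    intro t
    -- first block
    have hb : ∀ w w', t ^ 2 / 2 * (v w - v w') ^ 2 - t ^ 4 / 24 * (v w - v w') ^ 4 ≤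
        1 - Real.cos (t * (v w - v w')) := by
      intro w w'
      have := (cvxr_taylorGap_mem (t * (v w - v w'))).2
      have e : (t * (v w - v w')) ^ 2 / 2 = t ^ 2 / 2 * (v w - v w') ^ 2 := by ring
      have e' : (t * (v w - v w')) ^ 4 / 24 = t ^ 4 / 24 * (v w - v w') ^ 4 := by ring
      linarith
    have hB1 : t ^ 2 / 2 * (c₀ * ∑ w, ∑ w', (v w - v w') ^ 2) -
        t ^ 4 / 24 * (c₀ * ∑ w, ∑ w', (v w - v w') ^ 4) ≤
        c₀ * ∑ w, ∑ w', (1 - Real.cos (t * (v w - v w'))) := by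
      have : ∑ w, ∑ w', (t ^ 2 / 2 * (v w - v w') ^ 2 - t ^ 4 / 24 * (v w - v w') ^ 4) ≤
          ∑ w, ∑ w', (1 - Real.cos (t * (v w - v w'))) :=
        Finset.sum_le_sum fun w _ => Finset.sum_le_sum fun w' _ => hb w w'
      have e : ∑ w, ∑ w', (t ^ 2 / 2 * (v w - v w') ^ 2 - t ^ 4 / 24 * (v w - v w') ^ 4) =
          t ^ 2 / 2 * ∑ w, ∑ w', (v w - v w') ^ 2 - t ^ 4 / 24 * ∑ w, ∑ w', (v w - v w') ^ 4 := by
        simp only [Finset.sum_sub_distrib, Finset.mul_sum]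
      rw [e] at this
      have := mul_le_mul_of_nonneg_left this hc₀.le
      linarith
    -- second block
    have hn : ∀ n ∈ s, t ^ 2 / 2 * ((c n).re * A n ^ 2) - t ^ 4 / 24 * (|(c n).re| * A n ^ 4) ≤
        (c n).re * (1 - Real.cos (t * A n)) := by
      intro n _
      obtain ⟨hg0, hg1⟩ := cvxr_taylorGap_mem (t * A n)
      set e := (t * A n) ^ 2 / 2 - (1 - Real.cos (t * A n)) with he
      have hcos : 1 - Real.cos (t * A n) = (t * A n) ^ 2 / 2 - e := by rw [he]; ring
      rw [hcos, mul_sub]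
      have h1 : (c n).re * e ≤ |(c n).re| * e := mul_le_mul_of_nonneg_right (le_abs_self _) hg0
      have h2 : |(c n).re| * e ≤ |(c n).re| * ((t * A n) ^ 4 / 24) :=
        mul_le_mul_of_nonneg_left hg1 (abs_nonneg _)
      have e1 : (c n).re * ((t * A n) ^ 2 / 2) = t ^ 2 / 2 * ((c n).re * A n ^ 2) := by ring
      have e2 : |(c n).re| * ((t * A n) ^ 4 / 24) = t ^ 4 / 24 * (|(c n).re| * A n ^ 4) := by ring
      linarith
    have hB2 : t ^ 2 / 2 * (∑ n ∈ s, (c n).re * A n ^ 2) - t ^ 4 / 24 * (∑ n ∈ s, |(c n).re| * A n ^ 4) ≤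
        ∑ n ∈ s, (c n).re * (1 - Real.cos (t * A n)) := by
      have := Finset.sum_le_sum hn
      rw [Finset.sum_sub_distrib, ← Finset.mul_sum, ← Finset.mul_sum] at this
      exact this
    have := heven t
    rw [hS, hQ]
    nlinarith [hB1, hB2, this]
  -- Step 3: `S ≤ 0`.
  have hSle : S ≤ 0 := by
    by_contra hpos
    push Not at hpos
    set ρ : ℝ := S / (Q + 1) with hρ
    have hρpos : 0 < ρ := div_pos hpos (by linarith)
    set t : ℝ := min 1 (ρ / 2) with ht
    have htpos : 0 < t := lt_min one_pos (by linarith)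
    have ht1 : t ≤ 1 := min_le_left _ _
    have htρ : t ≤ ρ / 2 := min_le_right _ _
    have ht2 : t ^ 2 < ρ := by
      calc t ^ 2 = t * t := sq t
        _ ≤ 1 * t := mul_le_mul_of_nonneg_right ht1 htpos.le
        _ = t := one_mul t
        _ < ρ := by linarith
    have h := hineq t
    -- divide by t²/2 > 0: S ≤ t²/12 · Q ≤ t² (Q + 1) < ρ (Q + 1) = S
    have ht2pos : 0 < t ^ 2 := by positivity
    have h' : S ≤ t ^ 2 / 12 * Q := by
      have e : t ^ 4 / 24 * Q = t ^ 2 / 2 * (t ^ 2 / 12 * Q) := by ring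
      rw [e] at h
      exact le_of_mul_le_mul_left h (by positivity)
    have h'' : t ^ 2 / 12 * Q ≤ t ^ 2 * (Q + 1) := by nlinarith
    have h3 : t ^ 2 * (Q + 1) < ρ * (Q + 1) := mul_lt_mul_of_pos_right ht2 (by linarith)
    have h4 : ρ * (Q + 1) = S := by rw [hρ]; field_simp
    linarith
  rw [hS] at hSle
  linarith

end HessianOrigin

end Summit.HubbardSuperconductivity.HubbardSuperconductivity.Theorems
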